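import Summits.HodgeConjecture.HodgeConjecture.Theorems.H413E2SWSplitPlaceFrameRiders
import Literature.NumberTheory.Automorphic.QuadraticHermitianNormSplitTorus
import Literature.NumberTheory.Weil1964.AdelicThetaDistribution
import HarnessLib

/-!
# H413 · E-2 · SW2 (iii) — the split-place frame reads the LEVI TORUS TWIST as a dilation of the `x`-half (letter `hLD`, frame part)

Cell `hodgecm-mathlib`, crux H413 (`stmt-HodgeConjecture-24833`), child line `Cruxes/H413/Lines/F0_E2SiegelWeilWeilRange.lean`,
`StubSW2` (iii), I-CLOSE step (S-1) (`Theorems/H413E2SWDilateBoundCM :: hbd_CM`, binder `hLD`); sibling of ★ `Theorems/H413E2SWSplitPlaceFrame`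
(p810752) and ★ `…FrameRiders` (p811230).  PROOF lane, `--supports stmt-HodgeConjecture-24833 --as helper`.  KERNEL MATHEMATICS ONLY (no
definition, no `sorry`).  HC_CM is proved only modulo the 7 printed citations until rung 0 closes; nothing here is about Hodge classes.

THE MATHEMATICS (Weil (1965) Chap. V n° 50, proof of Thm. 4, p. 74; Weil (1964) n° 13).  Let `v` split in `E`, `s ∈ F_v` with `s² = d`,
`β_v : X□(F_v) ≃ F_vⁿ × F_vⁿ` the split coordinates of ★ `exists_splitBeta_adicCompletion` (`β_v y = (y¹ + s 𝕋_v⁻¹ y², 𝕋_v y¹ − s y²)`) and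
`fr = (β_v × id) ∘ placeSplitting⁻¹ : X□(𝔸_F) ≃ (F_vⁿ × F_vⁿ) × X□(𝔸_F)^{(v)}` the frame.  The torus element `V = p₂ + q₂ δ ∈ 𝔸_E` of the
`W□`-member acts on `X□(𝔸_F) = 𝔸_F^{n+n}` (row vectors) through the matrix `M(p₂,q₂) = [[p₂, q₂ 𝕋], [d q₂ 𝕋⁻¹, p₂]]` (★ A-p12
`omega_conj_adelicSiegelLiftCont_of_torusShape`, ★ A-p16 `exists_lift_torus`: `ω(q) Ψ = Ψ(· M)`).  If `p₂`, `q₂` are LOCAL AT `v` (`p₂ z = z`,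
`q₂ z = 0` whenever `z_v = 0`) with `v`-components `a`, `b`, then `x ↦ x M` fixes `X□(𝔸_F)^{(v)}` pointwise (`vecMul_torus_eq_self_of_mem`), so
through the frame it is `(β_v ∘ (· M_v) ∘ β_v⁻¹) × id` (★ `placeSplitting_symm_linearMap_of_forall_mem`), and in the split coordinates
`· M_v` is the diagonal dilation by `(a + s b, a − s b)` (★ B-p04 `splitEquiv_torusTwist`): `fr (x M) = (((a + s b) (fr x).1.1, (a − s b) (fr x).1.2),
(fr x).2)` (`fr_vecMul_torus`); with `a + s b = r`, `a − s b = 1` this is the dilate `Ψ(fr⁻¹((r z₁, z₂), z'))` of (S-1) (`twistLM_torus_apply`).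
`exists_localTorusScalars` builds such `p₂ = 1 − ι_v 1 + ι_v a`, `q₂ = ι_v b`; `exists_splitPlaceFrame₃` re-exports the frame of
★ `exists_splitPlaceFrame₂` TOGETHER WITH the formula of `β_v`, so that its holder can apply these (and any further algebraic) riders.

References: A. Weil, *Sur la formule de Siegel dans la théorie des groupes classiques*, Acta Math. 113 (1965), Chap. V n° 50 p. 74
[cite: Weil1965, Chap. V n° 50, pp. 73–74]; A. Weil, *Sur certains groupes d'opérateurs unitaires*, Acta Math. 111 (1964), n° 13 p. 160
[cite: Weil1964, Chap. I n° 13 p. 160]; D. Bump, *Automorphic forms and representations* (1997), §3.3 Prop. 3.3.2 [cite: Bump1997, §3.3 Prop. 3.3.2].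
-/

set_option autoImplicit false
-- the cell's `Summit.HodgeConjecture.HodgeConjecture.…` namespace repeats the summit name by design (D-0017 layout)
set_option linter.dupNamespace false

noncomputable section

namespace Summit.HodgeConjecture.HodgeConjecture.Cruxes.H413.E2SWSplitPlaceFrame

open scoped Matrix NNReal ENNReal
open _root_.MeasureTheory NumberField IsDedekindDomain
open Literature.NumberTheory.Weil1964 Literature.NumberTheory.Weil1965 Literature.NumberTheory.Weil1965.UnitaryDoubling
open Literature.NumberTheory.Automorphic Literature.NumberTheory.Automorphic.UnitaryGroup
open Literature.NumberTheory.GelbartRogawski1991 Literature.NumberTheory.GelbartRogawski1991.UnitaryDualPair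
open Literature.NumberTheory.Automorphic.AdelicVector (evalAt evalAt_apply trivialAt placeSplitting single evalAt_single)

variable (F E : Type) [Field F] [NumberField F] [Field E] [NumberField E] [Algebra F E] [Algebra.IsQuadraticExtension F E]
  (c : E ≃ₐ[F] E) {δ : E} (hcδ : c δ = -δ) (hδ : δ ≠ 0) {d : F} (hd : δ * δ = algebraMap F E d)
  (N : ℕ) {n : ℕ} (e : Fin N × Fin 1 ≃ Fin n)
  (TV : Matrix (Fin N) (Fin N) F) (hV : TV.IsSymm) (hVd : IsUnit TV.det)
  (TW : Matrix (Fin 1) (Fin 1) F) (hW : TW.IsSymm) (hWd : IsUnit TW.det)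
  (v : HeightOneSpectrum (𝓞 F))

/-! ## §1 Scalars of `𝔸_F` local at `v` -/

/-- components of a product of adeles at a finite place (definitional). [folklore] -/
private theorem adele_snd_mul_apply (x y : AdeleRing (𝓞 F) F) (w : HeightOneSpectrum (𝓞 F)) :
    (x * y).2 w = x.2 w * y.2 w := rfl

/-- archimedean part of a product of adeles (definitional). [folklore] -/
private theorem adele_fst_mul (x y : AdeleRing (𝓞 F) F) : (x * y).1 = x.1 * y.1 := rfl

/-- `ι_v(b) · z = ι_v(b · z_v)`: multiplication by an adele supported at `v` only sees the `v`-component. [cite: Bump1997, §3.3 Prop. 3.3.2] -/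
theorem adeleSingleHom_mul (b : v.adicCompletion F) (z : AdeleRing (𝓞 F) F) :
    adeleSingleHom F v b * z = adeleSingleHom F v (b * AdelicGroupData.adeleEval F v z) := by
  refine AdelicVector.adele_ext ?_ fun w => ?_
  · rw [adele_fst_mul, adeleSingleHom_apply_fst, adeleSingleHom_apply_fst, zero_mul]
  · rw [adele_snd_mul_apply, adeleSingleHom_apply_snd, adeleSingleHom_apply_snd]
    by_cases hwv : w = v
    · subst hwv
      rw [finiteAdeleSingleHom_apply_self, finiteAdeleSingleHom_apply_self]
      rfl
    · rw [finiteAdeleSingleHom_apply_of_ne F v _ hwv, finiteAdeleSingleHom_apply_of_ne F v _ hwv, zero_mul]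

/-- **SCALARS LOCAL AT `v` WITH PRESCRIBED `v`-COMPONENTS**: for `a b ∈ F_v` the adeles `p₂ := 1 − ι_v(1) + ι_v(a)`, `q₂ := ι_v(b)` have
`(p₂)_v = a`, `(q₂)_v = b`, and act as `1`, `0` on every adele vanishing at `v`. [cite: Bump1997, §3.3 Prop. 3.3.2] -/
theorem exists_localTorusScalars (a b : v.adicCompletion F) :
    ∃ p₂ q₂ : AdeleRing (𝓞 F) F, AdelicGroupData.adeleEval F v p₂ = a ∧ AdelicGroupData.adeleEval F v q₂ = b ∧
      (∀ z : AdeleRing (𝓞 F) F, AdelicGroupData.adeleEval F v z = 0 → p₂ * z = z) ∧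
      (∀ z : AdeleRing (𝓞 F) F, AdelicGroupData.adeleEval F v z = 0 → q₂ * z = 0) := by
  refine ⟨1 - adeleSingleHom F v 1 + adeleSingleHom F v a, adeleSingleHom F v b, ?_, adeleEval_adeleSingleHom F v b,
    fun z hz => ?_, fun z hz => ?_⟩
  · rw [map_add, map_sub, map_one, adeleEval_adeleSingleHom, adeleEval_adeleSingleHom, sub_self, zero_add]
  · rw [add_mul, sub_mul, one_mul, adeleSingleHom_mul, adeleSingleHom_mul, hz, mul_zero, mul_zero, map_zero, sub_zero, add_zero]
  · rw [adeleSingleHom_mul, hz, mul_zero, map_zero]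

/-! ## §2 The torus matrix `M(p₂,q₂)` on row vectors: generic algebra, and triviality on `X□(𝔸_F)^{(v)}` -/

/-- row vector times `reindex (fromBlocks A B C D)`, in halves. [folklore] -/
private theorem vecMul_reindex_fromBlocks {R : Type*} [CommRing R] {m : ℕ} (A B C D : Matrix (Fin m) (Fin m) R)
    (x : Fin (m + m) → R) :
    x ᵥ* Matrix.reindex finSumFinEquiv finSumFinEquiv (Matrix.fromBlocks A B C D) =
      (Sum.elim (((x ∘ ⇑finSumFinEquiv) ∘ Sum.inl) ᵥ* A + ((x ∘ ⇑finSumFinEquiv) ∘ Sum.inr) ᵥ* C)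
          (((x ∘ ⇑finSumFinEquiv) ∘ Sum.inl) ᵥ* B + ((x ∘ ⇑finSumFinEquiv) ∘ Sum.inr) ᵥ* D)) ∘
        ⇑(finSumFinEquiv (m := m) (n := m)).symm := by
  rw [Matrix.reindex_apply, Matrix.submatrix_vecMul_equiv, Equiv.symm_symm, Matrix.vecMul_fromBlocks]

/-- **row vector times the torus matrix `M(a,b) = [[a, b G], [d b G⁻¹, a]]` for a SYMMETRIC `G`**, in halves:
`x M = (a x¹ + d b G⁻¹ x², b G x¹ + a x²)` — the column-vector spelling of ★ `split_torusTwist_finSum`. [cite: Weil1964, Chap. I n° 13 p. 160] -/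
private theorem vecMul_torus_eq {R : Type*} [CommRing R] {m : ℕ} (G : Matrix (Fin m) (Fin m) R) (hGs : G.IsSymm)
    (a b d' : R) (x : Fin (m + m) → R) :
    x ᵥ* Matrix.reindex finSumFinEquiv finSumFinEquiv (Matrix.fromBlocks (a • 1) (b • G) ((d' * b) • G⁻¹) (a • 1)) =
      (Sum.elim (a • ((x ∘ ⇑finSumFinEquiv) ∘ Sum.inl) + (d' * b) • (G⁻¹ *ᵥ ((x ∘ ⇑finSumFinEquiv) ∘ Sum.inr)))
          (b • (G *ᵥ ((x ∘ ⇑finSumFinEquiv) ∘ Sum.inl)) + a • ((x ∘ ⇑finSumFinEquiv) ∘ Sum.inr))) ∘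
        ⇑(finSumFinEquiv (m := m) (n := m)).symm := by
  have hGi : G⁻¹.IsSymm := hGs.inv
  rw [vecMul_reindex_fromBlocks, Matrix.vecMul_smul, Matrix.vecMul_smul, Matrix.vecMul_smul, Matrix.vecMul_smul,
    Matrix.vecMul_one, Matrix.vecMul_one, ← Matrix.mulVec_transpose G, ← Matrix.mulVec_transpose G⁻¹, hGs.eq, hGi.eq]

/-- `(x M)_v = x_v M_v`. [cite: Bump1997, §3.3 Prop. 3.3.2] -/
private theorem evalAt_vecMul {ι : Type} [Fintype ι] (A : Matrix ι ι (AdeleRing (𝓞 F) F)) (x : ι → AdeleRing (𝓞 F) F) :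
    evalAt F ι v (x ᵥ* A) = evalAt F ι v x ᵥ* A.map (AdelicGroupData.adeleEval F v) := by
  funext i
  change AdelicGroupData.adeleEval F v ((x ᵥ* A) i) = _
  rw [RingHom.map_vecMul]
  rfl

include hVd hWd in
/-- **THE TORUS MATRIX WITH SCALARS LOCAL AT `v` FIXES `X□(𝔸_F)^{(v)}` POINTWISE** (the `hL` of ★ `placeSplitting_symm_linearMap_of_forall_mem`):
if `p₂ z = z` and `q₂ z = 0` for every adele `z` with `z_v = 0`, then `y M(p₂,q₂) = y` for every `y` trivial at `v`.
[cite: Bump1997, §3.3 Prop. 3.3.2] -/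
theorem vecMul_torus_eq_self_of_mem (p₂ q₂ : AdeleRing (𝓞 F) F)
    (hp₂ : ∀ z : AdeleRing (𝓞 F) F, AdelicGroupData.adeleEval F v z = 0 → p₂ * z = z)
    (hq₂ : ∀ z : AdeleRing (𝓞 F) F, AdelicGroupData.adeleEval F v z = 0 → q₂ * z = 0)
    (M : Matrix (Fin (n + n)) (Fin (n + n)) (AdeleRing (𝓞 F) F))
    (hM : M = Matrix.reindex finSumFinEquiv finSumFinEquiv
      (Matrix.fromBlocks (p₂ • 1) (q₂ • adelicGram F e TV TW)
        ((algebraMap F (AdeleRing (𝓞 F) F) d * q₂) • (adelicGram F e TV TW)⁻¹) (p₂ • 1)))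
    (y : Fin (n + n) → AdeleRing (𝓞 F) F) (hy : y ∈ trivialAt F (Fin (n + n)) v) : y ᵥ* M = y := by
  have _hT : IsUnit (adelicGram F e TV TW).det := isUnit_det_adelicGram F e hVd hWd
  have hy0 : ∀ i, AdelicGroupData.adeleEval F v (y i) = 0 := fun i =>
    congr_fun (AdelicVector.evalAt_eq_zero_of_mem hy) i
  have h1 : ∀ z : Fin n → AdeleRing (𝓞 F) F, (∀ i, AdelicGroupData.adeleEval F v (z i) = 0) → p₂ • z = z :=
    fun z hz => funext fun i => by rw [Pi.smul_apply, smul_eq_mul]; exact hp₂ _ (hz i)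
  have h2 : ∀ (cst : AdeleRing (𝓞 F) F), (∀ z : AdeleRing (𝓞 F) F, AdelicGroupData.adeleEval F v z = 0 → cst * z = 0) →
      ∀ (z : Fin n → AdeleRing (𝓞 F) F) (A : Matrix (Fin n) (Fin n) (AdeleRing (𝓞 F) F)),
        (∀ i, AdelicGroupData.adeleEval F v (z i) = 0) → cst • (z ᵥ* A) = 0 := by
    intro cst hcst z A hz
    funext j
    rw [Pi.smul_apply, smul_eq_mul, Pi.zero_apply]
    refine hcst _ ?_
    rw [RingHom.map_vecMul]
    have hz' : (⇑(AdelicGroupData.adeleEval F v) ∘ z) = 0 := funext hz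
    rw [hz', Matrix.zero_vecMul, Pi.zero_apply]
  have hdq : ∀ z : AdeleRing (𝓞 F) F, AdelicGroupData.adeleEval F v z = 0 → algebraMap F (AdeleRing (𝓞 F) F) d * q₂ * z = 0 :=
    fun z hz => by rw [mul_assoc, hq₂ z hz, mul_zero]
  rw [hM, vecMul_reindex_fromBlocks, Matrix.vecMul_smul, Matrix.vecMul_smul, Matrix.vecMul_smul, Matrix.vecMul_smul,
    Matrix.vecMul_one, Matrix.vecMul_one, h1 ((y ∘ ⇑finSumFinEquiv) ∘ Sum.inl) (fun i => hy0 _),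
    h1 ((y ∘ ⇑finSumFinEquiv) ∘ Sum.inr) (fun i => hy0 _),
    h2 q₂ hq₂ ((y ∘ ⇑finSumFinEquiv) ∘ Sum.inl) (adelicGram F e TV TW) (fun i => hy0 _),
    h2 _ hdq ((y ∘ ⇑finSumFinEquiv) ∘ Sum.inr) (adelicGram F e TV TW)⁻¹ (fun i => hy0 _), add_zero, zero_add,
    Sum.elim_comp_inl_inr]
  funext i
  simp only [Function.comp_apply, Equiv.apply_symm_apply]

/-! ## §3 The frame reads `x ↦ x M(p₂,q₂)` as the diagonal dilation `(a + s b, a − s b)` of the split halves -/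

omit [Algebra.IsQuadraticExtension F E] in
/-- a principal adele read at `v` (definitional). [folklore] -/
private theorem adeleEval_algebraMap' (x : F) :
    AdelicGroupData.adeleEval F v (algebraMap F (AdeleRing (𝓞 F) F) x) = algebraMap F (v.adicCompletion F) x := rfl

include hVd hWd in
/-- `M(p₂,q₂)` read at `v` is the local torus matrix `M(a,b)` over `𝕋_v`. [cite: GelbartRogawski1991, §3.1 p. 454] -/
private theorem map_adeleEval_torus (p₂ q₂ : AdeleRing (𝓞 F) F) (a b : v.adicCompletion F)
    (hp₂v : AdelicGroupData.adeleEval F v p₂ = a) (hq₂v : AdelicGroupData.adeleEval F v q₂ = b) :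
    (Matrix.reindex finSumFinEquiv finSumFinEquiv
      (Matrix.fromBlocks (p₂ • 1) (q₂ • adelicGram F e TV TW)
        ((algebraMap F (AdeleRing (𝓞 F) F) d * q₂) • (adelicGram F e TV TW)⁻¹) (p₂ • 1)) :
          Matrix (Fin (n + n)) (Fin (n + n)) (AdeleRing (𝓞 F) F)).map (AdelicGroupData.adeleEval F v) =
      Matrix.reindex finSumFinEquiv finSumFinEquiv
        (Matrix.fromBlocks (a • 1) (b • (gram F e TV TW).map (algebraMap F (v.adicCompletion F)))
          ((algebraMap F (v.adicCompletion F) d * b) • ((gram F e TV TW).map (algebraMap F (v.adicCompletion F)))⁻¹) (a • 1)) := by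
  have hm : ∀ a₁ a₂ : AdeleRing (𝓞 F) F, AdelicGroupData.adeleEval F v (a₁ * a₂) =
      AdelicGroupData.adeleEval F v a₁ * AdelicGroupData.adeleEval F v a₂ := fun a₁ a₂ => map_mul _ a₁ a₂
  rw [Matrix.reindex_apply, Matrix.reindex_apply, ← Matrix.submatrix_map, Matrix.fromBlocks_map, Matrix.map_smul' _ _ _ hm,
    Matrix.map_smul' _ _ _ hm, Matrix.map_smul' _ _ _ hm, Matrix.map_one _ (map_zero _) (map_one _),
    map_adeleEval_adelicGram F N e TV TW v, map_adeleEval_adelicGram_inv F N e TV hVd TW hWd v, map_mul, hp₂v, hq₂v,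
    adeleEval_algebraMap']

include hV hW hVd hWd in
/-- **THE FRAME READS THE TORUS TWIST AS A DILATION OF THE HALVES**: for `β_v` with its defining formula, the frame
`fr = (β_v × id) ∘ placeSplitting⁻¹`, scalars `p₂ q₂` local at `v` with `v`-components `a b`, and `M = M(p₂,q₂)`:
`fr (x M) = (((a + s b) • (fr x).1.1, (a − s b) • (fr x).1.2), (fr x).2)`.  Weil (1965) n° 50 p. 74: the torus of the `W□`-member acts on
the `x`∕`y`-halves of `X_v` by `(V_w, V_w̄)`. [cite: Weil1965, Chap. V n° 50, pp. 73–74] -/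
theorem fr_vecMul_torus {s : v.adicCompletion F} (hs : s * s = algebraMap F (v.adicCompletion F) d)
    (β : (Fin (n + n) → v.adicCompletion F) ≃ₗ[v.adicCompletion F] ((Fin n → v.adicCompletion F) × (Fin n → v.adicCompletion F)))
    (hβ : ∀ y, β y =
        ((fun i => y (Fin.castAdd n i)) +
            s • ((UnitaryDualPair.gram F e TV TW).map (algebraMap F (v.adicCompletion F)))⁻¹ *ᵥ (fun i => y (Fin.natAdd n i)),
          (UnitaryDualPair.gram F e TV TW).map (algebraMap F (v.adicCompletion F)) *ᵥ (fun i => y (Fin.castAdd n i)) -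
            s • (fun i => y (Fin.natAdd n i))))
    (fr : (Fin (n + n) → AdeleRing (𝓞 F) F) ≃ₜ
      ((Fin n → v.adicCompletion F) × (Fin n → v.adicCompletion F)) × trivialAt F (Fin (n + n)) v)
    (hfr : ∀ x, fr x = (β (evalAt F (Fin (n + n)) v x), ((placeSplitting F (Fin (n + n)) v).symm x).2))
    (p₂ q₂ : AdeleRing (𝓞 F) F) (a b : v.adicCompletion F)
    (hp₂v : AdelicGroupData.adeleEval F v p₂ = a) (hq₂v : AdelicGroupData.adeleEval F v q₂ = b)
    (hp₂ : ∀ z : AdeleRing (𝓞 F) F, AdelicGroupData.adeleEval F v z = 0 → p₂ * z = z)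
    (hq₂ : ∀ z : AdeleRing (𝓞 F) F, AdelicGroupData.adeleEval F v z = 0 → q₂ * z = 0)
    (M : Matrix (Fin (n + n)) (Fin (n + n)) (AdeleRing (𝓞 F) F))
    (hM : M = Matrix.reindex finSumFinEquiv finSumFinEquiv
      (Matrix.fromBlocks (p₂ • 1) (q₂ • adelicGram F e TV TW)
        ((algebraMap F (AdeleRing (𝓞 F) F) d * q₂) • (adelicGram F e TV TW)⁻¹) (p₂ • 1)))
    (x : Fin (n + n) → AdeleRing (𝓞 F) F) :
    fr (x ᵥ* M) = ((((a + s * b) • (fr x).1.1, (a - s * b) • (fr x).1.2)), (fr x).2) := by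
  have hL : ∀ h ∈ trivialAt F (Fin (n + n)) v, Matrix.vecMulLinear M h = h := fun h hh => by
    rw [Matrix.vecMulLinear_apply]
    exact vecMul_torus_eq_self_of_mem F N e TV hVd TW hWd v p₂ q₂ hp₂ hq₂ M hM h hh
  have hsnd : ((placeSplitting F (Fin (n + n)) v).symm (x ᵥ* M)).2 = ((placeSplitting F (Fin (n + n)) v).symm x).2 := by
    have h := AdelicVector.placeSplitting_symm_linearMap_of_forall_mem (Matrix.vecMulLinear M) hL x
    rw [Matrix.vecMulLinear_apply] at h
    rw [h]
  have hG : IsUnit ((gram F e TV TW).map (algebraMap F (v.adicCompletion F))).det :=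
    isUnit_det_gram_map_adicCompletion F N e TV hVd TW hWd v
  have hGs : ((gram F e TV TW).map (algebraMap F (v.adicCompletion F))).IsSymm :=
    ((isSymm_kronecker hV hW).submatrix e.symm).map _
  rw [hfr, hfr, hsnd, evalAt_vecMul, hM, map_adeleEval_torus F N e TV hVd TW hWd v p₂ q₂ a b hp₂v hq₂v,
    vecMul_torus_eq _ hGs a b _ (evalAt F (Fin (n + n)) v x), splitEquiv_torusTwist _ hG hs β hβ a b (evalAt F (Fin (n + n)) v x)]

include hV hW hVd hWd in
/-- **THE (S-1) DILATE**: with `a + s b = r` and `a − s b = 1` (the one-place torus element `(V_w, V_w̄) = (r, 1)`) and `Mt = M(p₂,q₂)` in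
`GL_{n+n}(𝔸_F)`, the twist `Ψ ↦ Ψ(· Mt)` of `𝒮(X□(𝔸_F))` is, through the frame, the dilation of the `x`-half ALONE:
`(twistLM Mt Ψ) x = Ψ (fr⁻¹ ((r • (fr x).1.1, (fr x).1.2), (fr x).2))` — the last clause of the `hLD` binder of ★ `hbd_CM` (Weil's (39)).
[cite: Weil1965, Chap. V n° 50, pp. 73–74] -/
theorem twistLM_torus_apply {s : v.adicCompletion F} (hs : s * s = algebraMap F (v.adicCompletion F) d)
    (β : (Fin (n + n) → v.adicCompletion F) ≃ₗ[v.adicCompletion F] ((Fin n → v.adicCompletion F) × (Fin n → v.adicCompletion F)))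
    (hβ : ∀ y, β y =
        ((fun i => y (Fin.castAdd n i)) +
            s • ((UnitaryDualPair.gram F e TV TW).map (algebraMap F (v.adicCompletion F)))⁻¹ *ᵥ (fun i => y (Fin.natAdd n i)),
          (UnitaryDualPair.gram F e TV TW).map (algebraMap F (v.adicCompletion F)) *ᵥ (fun i => y (Fin.castAdd n i)) -
            s • (fun i => y (Fin.natAdd n i))))
    (fr : (Fin (n + n) → AdeleRing (𝓞 F) F) ≃ₜ
      ((Fin n → v.adicCompletion F) × (Fin n → v.adicCompletion F)) × trivialAt F (Fin (n + n)) v)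
    (hfr : ∀ x, fr x = (β (evalAt F (Fin (n + n)) v x), ((placeSplitting F (Fin (n + n)) v).symm x).2))
    (p₂ q₂ : AdeleRing (𝓞 F) F) (a b : v.adicCompletion F)
    (hp₂v : AdelicGroupData.adeleEval F v p₂ = a) (hq₂v : AdelicGroupData.adeleEval F v q₂ = b)
    (hp₂ : ∀ z : AdeleRing (𝓞 F) F, AdelicGroupData.adeleEval F v z = 0 → p₂ * z = z)
    (hq₂ : ∀ z : AdeleRing (𝓞 F) F, AdelicGroupData.adeleEval F v z = 0 → q₂ * z = 0)
    (Mt : GL (Fin (n + n)) (AdeleRing (𝓞 F) F))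
    (hMt : (Mt : Matrix (Fin (n + n)) (Fin (n + n)) (AdeleRing (𝓞 F) F)) = Matrix.reindex finSumFinEquiv finSumFinEquiv
      (Matrix.fromBlocks (p₂ • 1) (q₂ • adelicGram F e TV TW)
        ((algebraMap F (AdeleRing (𝓞 F) F) d * q₂) • (adelicGram F e TV TW)⁻¹) (p₂ • 1)))
    {r : v.adicCompletion F} (hw : a + s * b = r) (hwbar : a - s * b = 1)
    (Ψ : piSchwartzBruhat F (Fin (n + n))) (x : Fin (n + n) → AdeleRing (𝓞 F) F) :
    ((twistLM F Mt Ψ : piSchwartzBruhat F (Fin (n + n))) : (Fin (n + n) → AdeleRing (𝓞 F) F) → ℂ) x =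
      (Ψ : (Fin (n + n) → AdeleRing (𝓞 F) F) → ℂ) (fr.symm (((r • (fr x).1.1, (fr x).1.2)), (fr x).2)) := by
  have h3 := fr_vecMul_torus F N e TV hV hVd TW hW hWd v hs β hβ fr hfr p₂ q₂ a b hp₂v hq₂v hp₂ hq₂ _ hMt x
  rw [hw, hwbar, one_smul] at h3
  rw [coe_twistLM, twist_apply, ← h3, Homeomorph.symm_apply_apply]

/-! ## §4 The frame of ★ `exists_splitPlaceFrame₂` with the formula of `β_v` exported -/

include hδ in
/-- **THE SPLIT-PLACE FRAME, ITS RIDERS, AND THE FORMULA OF `β_v`**: ★ `exists_splitPlaceFrame₂` (E1 `(h x)_v = (β x_v).1 ⬝ᵥ (β x_v).2`,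
E2 Haar, E3 every `P ∈ GL_n(F_v)` realised `v`-supportedly, `hrat`, `hint`) for a `β_v` GIVEN BY THE FORMULA `β_v y = (y¹ + s 𝕋_v⁻¹ y², 𝕋_v y¹ − s y²)`
(first clause) — so that its holder can read every algebraic rider (`fr_vecMul_torus`, `twistLM_torus_apply`, ★ `splitEquiv_torusTwist`, …)
on the SAME `β_v`. [cite: Weil1965, Chap. V n° 50, pp. 73–74] -/
theorem exists_splitPlaceFrame₃ {s : v.adicCompletion F} (hs : s * s = algebraMap F (v.adicCompletion F) d)
    [MeasurableSpace (v.adicCompletion F)] [BorelSpace (v.adicCompletion F)]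
    (μ : Measure (v.adicCompletion F)) [μ.IsAddHaarMeasure] :
    ∃ β : (Fin (n + n) → v.adicCompletion F) ≃ₗ[v.adicCompletion F] ((Fin n → v.adicCompletion F) × (Fin n → v.adicCompletion F)),
      (∀ y, β y =
        ((fun i => y (Fin.castAdd n i)) +
            s • ((UnitaryDualPair.gram F e TV TW).map (algebraMap F (v.adicCompletion F)))⁻¹ *ᵥ (fun i => y (Fin.natAdd n i)),
          (UnitaryDualPair.gram F e TV TW).map (algebraMap F (v.adicCompletion F)) *ᵥ (fun i => y (Fin.castAdd n i)) -
            s • (fun i => y (Fin.natAdd n i)))) ∧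
      (∀ x : Fin (n + n) → AdeleRing (𝓞 F) F,
        AdelicGroupData.adeleEval F v (hNorm F E c hcδ hδ N e TV hVd TW hWd x) =
          (β (evalAt F (Fin (n + n)) v x)).1 ⬝ᵥ (β (evalAt F (Fin (n + n)) v x)).2) ∧
      (∃ cst : ℝ≥0, 0 < cst ∧
        Measure.map β (Measure.pi fun _ : Fin (n + n) => μ) =
          (cst : ℝ≥0∞) • ((Measure.pi fun _ : Fin n => μ).prod (Measure.pi fun _ : Fin n => μ))) ∧
      (∀ P : GL (Fin n) (v.adicCompletion F), ∃ h : UnitaryGroup.adelic F E c N (TV.map (algebraMap F E)),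
        (∀ y ∈ trivialAt F (Fin (n + n)) v, vDiagAct F E c hcδ hδ hd N e TV hV hVd TW hW hWd h y = y) ∧
        (∀ x : Fin (n + n) → AdeleRing (𝓞 F) F,
          β (evalAt F (Fin (n + n)) v (vDiagAct F E c hcδ hδ hd N e TV hV hVd TW hW hWd h x)) =
            ((P : Matrix (Fin n) (Fin n) (v.adicCompletion F)) *ᵥ (β (evalAt F (Fin (n + n)) v x)).1,
              ((P⁻¹ : GL (Fin n) (v.adicCompletion F)) : Matrix (Fin n) (Fin n) (v.adicCompletion F))ᵀ *ᵥ
                (β (evalAt F (Fin (n + n)) v x)).2)) ∧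
        (∀ x : Fin (n + n) → AdeleRing (𝓞 F) F,
          ((placeSplitting F (Fin (n + n)) v).symm (vDiagAct F E c hcδ hδ hd N e TV hV hVd TW hW hWd h x)).2 =
            ((placeSplitting F (Fin (n + n)) v).symm x).2)) ∧
      (∀ ξ : Fin (n + n) → F, ξ ≠ 0 →
        (β (evalAt F (Fin (n + n)) v (ratPt F (Fin (n + n)) ξ))).1 ≠ 0 ∧
          (β (evalAt F (Fin (n + n)) v (ratPt F (Fin (n + n)) ξ))).2 ≠ 0) ∧
      (∀ hU : UnitaryGroup.adelic F E c N (TV.map (algebraMap F E)), ∃ g : GL (Fin n) (v.adicCompletion F),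
        ∀ x : Fin (n + n) → AdeleRing (𝓞 F) F,
          β (evalAt F (Fin (n + n)) v (vDiagAct F E c hcδ hδ hd N e TV hV hVd TW hW hWd hU x)) =
            ((g : Matrix (Fin n) (Fin n) (v.adicCompletion F)) *ᵥ (β (evalAt F (Fin (n + n)) v x)).1,
              ((g⁻¹ : GL (Fin n) (v.adicCompletion F)) : Matrix (Fin n) (Fin n) (v.adicCompletion F))ᵀ *ᵥ
                (β (evalAt F (Fin (n + n)) v x)).2)) := by
  obtain ⟨β, hβ, -, hQ, hHaar⟩ := exists_splitBeta_adicCompletion F E hδ hd N e TV hV hVd TW hW hWd v μ hs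
  refine ⟨β, hβ, fun x => ?_, hHaar, fun P => exists_vSupported_realising F E c hcδ hδ hd N e TV hV hVd TW hW hWd v hs β hβ P,
    fun ξ hξ => beta_evalAt_ratPt_ne_zero F E c hcδ hδ hd N e TV hVd TW hWd v hs β hβ ξ hξ,
    fun hU => exists_gl_frame_intertwine F E c hcδ hδ hd N e TV hV hVd TW hW hWd v hs β hβ hU⟩
  rw [evalAt_hNorm F E c hcδ hδ hd N e TV hVd TW hWd v x]
  exact hQ _

end Summit.HodgeConjecture.HodgeConjecture.Cruxes.H413.E2SWSplitPlaceFrame
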